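import Summits.ValiantsHypothesis.ValiantsHypothesis.Theorems.MonotoneRestorationOrbitRestorationQPValueSupport
import HarnessLib

/-!
# Small stable spaces of affine forms are invariant (ORBIT currency, XIX)

Route MonotoneRestoration, crux `OrbitRestorationQP` (stmt-ValiantsHypothesis-18293), namespace
`Summit.ValiantsHypothesis.ValiantsHypothesis.Theorems.StableForms`.  Route-independent (no `Theses` import).

A building block of the bounded-top-fan-in sub-rung (`k = O(1)`) of stub A of line `depth-three-rung` (crux workfile
`Cruxes/OrbitRestorationQP/Lines/depth-three-rung-stubA-bounded-fanin.md`, Structure Theorem S, step (e)): after the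
Karnin–Shpilka rank-distance clustering and the rank bound for ΣΠΣ(k) identities, the non-linear part of each cluster sum is a
polynomial in the forms of an `Sym(Fin n)`-STABLE space of affine forms of dimension `O_k(log n)`; this file shows that such a
space consists of INVARIANT forms (so that part is a polynomial in `Σ_p x_pp` and `Σ_{p≠q} x_pq`).

`forall_ren_eq_of_finrank` : if `W` is a finite-dimensional subspace of polynomials of total degree `≤ 1` on the `n × n` matrix,
stable under the diagonal action of every permutation, and `4·dim W + 8 ≤ n`, then every element of `W` is fixed by every
permutation.  ELEMENTARY proof (no representation theory): if a transposition `τ = (a b)` moves `w ∈ W`, then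
`v := τ·w − w ∈ W` is a nonzero linear form whose coefficients vanish off the rows and columns `a, b`; pick a position `P` with
nonzero coefficient and `dim W + 1` permutations `π_i` carrying `A := {a, b, P.1, P.2}` into pairwise disjoint blocks
(`exists_perm_extend`, Mathlib `Finset.exists_equiv_extend_of_card_eq`); the coefficient of `π_i·v` at `π_i·P` is that of `v` at `P`,
while the coefficient of `π_j·v` there vanishes for `j ≠ i` (both coordinates of `π_j⁻¹ π_i P` lie outside `{a,b}`); so the
`π_i·v` are linearly independent in `W` — too many.  Transpositions generate (`Equiv.Perm.swap_induction_on`).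

Everything is proved. [folklore]

## References
* Z. S. Karnin, A. Shpilka, *Reconstruction of generalized depth-3 arithmetic circuits with bounded top fan-in*, CCC 2009
  (rank distance). [SaxenaSeshadhri2013 for the rank bound]
* A. Dawar, G. Wilsenach, *Symmetric arithmetic circuits*, ToC 21 (2025), §3.3. [DawarWilsenach2025]
-/

noncomputable section

open scoped Classical

-- `Summit.ValiantsHypothesis.ValiantsHypothesis.…` is the tree's single-conjunct layout (Sub = Summit).
set_option linter.dupNamespace false

namespace Summit.ValiantsHypothesis.ValiantsHypothesis.Theorems

namespace StableForms

open Equiv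

variable {n : ℕ}

/-! ### Coefficients under renaming -/

/-- The coefficient of `x_P` in `ren ρ q` is the coefficient of `x_{ρ⁻¹ P}` in `q`. [folklore] -/
theorem coeff_single_ren (ρ : Perm (Fin n)) (q : MvPolynomial (Fin n × Fin n) ℂ) (P : Fin n × Fin n) :
    MvPolynomial.coeff (Finsupp.single P 1) (ren ρ q) =
      MvPolynomial.coeff (Finsupp.single (ρ⁻¹ • P) 1) q := by
  have h := MvPolynomial.coeff_rename_mapDomain (fun x : Fin n × Fin n => ρ • x) (MulAction.injective ρ) q
    (Finsupp.single (ρ⁻¹ • P) 1)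
  rw [Finsupp.mapDomain_single, smul_inv_smul] at h
  exact h

/-- The constant coefficient is unchanged by renaming. [folklore] -/
theorem coeff_zero_ren (ρ : Perm (Fin n)) (q : MvPolynomial (Fin n × Fin n) ℂ) :
    MvPolynomial.coeff 0 (ren ρ q) = MvPolynomial.coeff 0 q := by
  have h := MvPolynomial.coeff_rename_mapDomain (fun x : Fin n × Fin n => ρ • x) (MulAction.injective ρ) q 0
  rw [Finsupp.mapDomain_zero] at h
  exact h

/-- A polynomial of total degree `≤ 1` with vanishing constant and linear coefficients is zero. [folklore] -/
theorem eq_zero_of_coeffs {v : MvPolynomial (Fin n × Fin n) ℂ} (hv : v.totalDegree ≤ 1)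
    (h0 : MvPolynomial.coeff 0 v = 0) (h1 : ∀ P, MvPolynomial.coeff (Finsupp.single P 1) v = 0) : v = 0 := by
  rw [eqvTerms_affine_eq v hv, h0, map_zero, zero_add]
  exact Finset.sum_eq_zero fun P _ => by rw [h1 P, map_zero, zero_mul]

/-! ### Extending an injection on a finite set to a permutation -/

/-- An injection defined on a finite set of indices extends to a permutation (Mathlib
`Finset.exists_equiv_extend_of_card_eq`). [folklore] -/
theorem exists_perm_extend {A : Finset (Fin n)} {f : Fin n → Fin n} (hf : Set.InjOn f A) :
    ∃ σ : Perm (Fin n), ∀ x ∈ A, σ x = f x := by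
  obtain ⟨g, hg⟩ := Finset.exists_equiv_extend_of_card_eq (t := (Finset.univ : Finset (Fin n)))
    (Finset.card_univ (α := Fin n)).symm (s := A) (f := f) (Finset.subset_univ _) hf
  refine ⟨g.trans (Equiv.subtypeUnivEquiv Finset.mem_univ), fun x hx => ?_⟩
  rw [Equiv.trans_apply]
  exact hg x hx

/-! ### The translates of a cross-supported form are independent -/

/-- **Main step.**  If a transposition `swap a b` moves some `w ∈ W` (`W` stable under all permutations, forms of degree
`≤ 1`), then `W` contains `m` linearly independent vectors whenever `4m + 4 ≤ n`. [folklore] -/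
theorem le_finrank_of_swap_moves {W : Submodule ℂ (MvPolynomial (Fin n × Fin n) ℂ)} [FiniteDimensional ℂ W]
    (hdeg : ∀ w ∈ W, MvPolynomial.totalDegree w ≤ 1)
    (hstab : ∀ (σ : Perm (Fin n)) (w : MvPolynomial (Fin n × Fin n) ℂ), w ∈ W → ren σ w ∈ W)
    {w : MvPolynomial (Fin n × Fin n) ℂ} (hw : w ∈ W) {a b : Fin n} (hmove : ren (swap a b) w ≠ w)
    {m : ℕ} (hroom : 4 * m + 4 ≤ n) : m ≤ Module.finrank ℂ W := by
  -- the moved difference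
  set v := ren (swap a b) w - w with hv
  have hvW : v ∈ W := W.sub_mem (hstab _ w hw) hw
  have hv0 : v ≠ 0 := fun h => hmove (sub_eq_zero.1 h)
  have hv1 : v.totalDegree ≤ 1 := hdeg v hvW
  set c : Fin n × Fin n → ℂ := fun P => MvPolynomial.coeff (Finsupp.single P 1) v with hc
  -- coefficients of `v`: constant term zero, and zero off the cross of `{a, b}`
  have hc0 : MvPolynomial.coeff 0 v = 0 := by
    rw [hv, MvPolynomial.coeff_sub, coeff_zero_ren, sub_self]
  have hcross : ∀ P : Fin n × Fin n, P.1 ≠ a → P.1 ≠ b → P.2 ≠ a → P.2 ≠ b → c P = 0 := by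
    intro P h1a h1b h2a h2b
    simp only [hc, hv, MvPolynomial.coeff_sub, coeff_single_ren, swap_inv]
    rw [show swap a b • P = P from Prod.ext (swap_apply_of_ne_of_ne h1a h1b) (swap_apply_of_ne_of_ne h2a h2b),
      sub_self]
  -- a position with nonzero coefficient
  obtain ⟨P, hP⟩ : ∃ P, c P ≠ 0 := by
    by_contra hall
    exact hv0 (eq_zero_of_coeffs hv1 hc0 fun P => not_not.1 fun h => hall ⟨P, h⟩)
  -- the exceptional set `A` and its complement
  set A : Finset (Fin n) := {a, b, P.1, P.2} with hA
  have hAcard : A.card ≤ 4 := by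
    refine (Finset.card_insert_le _ _).trans ?_
    refine (Nat.succ_le_succ (Finset.card_insert_le _ _)).trans ?_
    refine (Nat.succ_le_succ (Nat.succ_le_succ (Finset.card_insert_le _ _))).trans ?_
    rw [Finset.card_singleton]
  set ℓ := A.card with hℓ
  set s : Finset (Fin n) := Finset.univ \ A with hs
  have hscard : s.card = n - ℓ := by
    rw [hs, Finset.card_sdiff_of_subset (Finset.subset_univ _), Finset.card_univ, Fintype.card_fin]
  have hroom' : ℓ * m ≤ s.card := by
    rw [hscard]
    have : ℓ * m ≤ 4 * m := Nat.mul_le_mul_right m hAcard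
    omega
  -- enumerations
  let idx : A ≃o Fin ℓ := (A.orderIsoOfFin rfl).symm
  let βe : Fin s.card ↪o Fin n := s.orderEmbOfFin rfl
  have hβs : ∀ j, βe j ∈ s := fun j => Finset.orderEmbOfFin_mem s rfl j
  have hβA : ∀ j, βe j ∉ A := fun j => (Finset.mem_sdiff.1 (hβs j)).2
  -- the block maps
  have hbound : ∀ (i : Fin m) (j : Fin ℓ), ℓ * (i : ℕ) + j < s.card := by
    intro i j
    have h1 : ℓ * (i : ℕ) + j < ℓ * (i + 1) := by rw [Nat.mul_succ]; exact Nat.add_lt_add_left j.2 _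
    exact lt_of_lt_of_le h1 ((Nat.mul_le_mul_left ℓ (Nat.succ_le_of_lt i.2)).trans hroom')
  let blk : Fin m → Fin ℓ → Fin n := fun i j => βe ⟨ℓ * (i : ℕ) + j, hbound i j⟩
  have hblk_inj : ∀ i i' j j', blk i j = blk i' j' → i = i' ∧ j = j' := by
    intro i i' j j' h
    have h' : ℓ * (i : ℕ) + j = ℓ * (i' : ℕ) + j' := congrArg Fin.val (βe.injective h)
    have key : ∀ (x y x' y' : ℕ), y < ℓ → y' < ℓ → ℓ * x + y = ℓ * x' + y' → x < x' → False := by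
      intro x y x' y' hy _ hxy hlt
      have : ℓ * x + y < ℓ * x' + y' :=
        calc ℓ * x + y < ℓ * x + ℓ := Nat.add_lt_add_left hy _
          _ = ℓ * (x + 1) := (Nat.mul_succ ℓ x).symm
          _ ≤ ℓ * x' := Nat.mul_le_mul_left ℓ hlt
          _ ≤ ℓ * x' + y' := Nat.le_add_right _ _
      omega
    have hi : (i : ℕ) = i' := by
      rcases lt_trichotomy (i : ℕ) i' with hlt | heq | hgt
      · exact (key _ _ _ _ j.2 j'.2 h' hlt).elim
      · exact heq
      · exact (key _ _ _ _ j'.2 j.2 h'.symm hgt).elim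
    refine ⟨Fin.ext hi, Fin.ext ?_⟩
    rw [hi] at h'; omega
  let f : Fin m → Fin n → Fin n := fun i x => if hx : x ∈ A then blk i (idx ⟨x, hx⟩) else x
  have hf_inj : ∀ i, Set.InjOn (f i) A := by
    intro i x hx y hy hxy
    simp only [f, Finset.mem_coe.1 hx, Finset.mem_coe.1 hy, dif_pos] at hxy
    have := (hblk_inj i i _ _ hxy).2
    have := idx.injective this
    exact congrArg Subtype.val this
  -- the permutations
  choose π hπ using fun i => exists_perm_extend (hf_inj i)
  have hπA : ∀ (i) (x : Fin n) (hx : x ∈ A), π i x = blk i (idx ⟨x, hx⟩) := by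
    intro i x hx
    rw [hπ i x hx]; simp only [f, dif_pos hx]
  have hπ_notA : ∀ i, ∀ x ∈ A, π i x ∉ A := fun i x hx => by rw [hπA i x hx]; exact hβA _
  have hπ_disj : ∀ i i', i ≠ i' → ∀ x ∈ A, ∀ y ∈ A, π i x ≠ π i' y := by
    intro i i' hii' x hx y hy h
    rw [hπA i x hx, hπA i' y hy] at h
    exact hii' (hblk_inj _ _ _ _ h).1
  have haA : a ∈ A := by simp [hA]
  have hbA : b ∈ A := by simp [hA]
  have hP1A : P.1 ∈ A := by simp [hA]
  have hP2A : P.2 ∈ A := by simp [hA]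
  -- the translates and their coefficients at the exclusive positions
  set u : Fin m → MvPolynomial (Fin n × Fin n) ℂ := fun i => ren (π i) v with hu
  have huW : ∀ i, u i ∈ W := fun i => hstab _ v hvW
  have hdiag : ∀ i, MvPolynomial.coeff (Finsupp.single (π i • P) 1) (u i) = c P := by
    intro i; simp only [hu, coeff_single_ren, inv_smul_smul, hc]
  have hoff : ∀ i j, i ≠ j → MvPolynomial.coeff (Finsupp.single (π i • P) 1) (u j) = 0 := by
    intro i j hij
    simp only [hu, coeff_single_ren]
    have key : ∀ x ∈ A, ∀ y ∈ A, (π j)⁻¹ (π i x) ≠ y := fun x hx y hy h =>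
      hπ_disj i j hij x hx y hy (Perm.inv_eq_iff_eq.1 h)
    exact hcross _ (key P.1 hP1A a haA) (key P.1 hP1A b hbA) (key P.2 hP2A a haA) (key P.2 hP2A b hbA)
  -- linear independence in the ambient space
  have hli : LinearIndependent ℂ u := by
    rw [linearIndependent_iff']
    intro S g hsum i hi
    have h := congrArg (MvPolynomial.coeff (Finsupp.single (π i • P) 1)) hsum
    rw [MvPolynomial.coeff_sum, MvPolynomial.coeff_zero, Finset.sum_eq_single i] at h
    · rw [MvPolynomial.coeff_smul, hdiag, smul_eq_mul] at h
      exact (mul_eq_zero.1 h).resolve_right hP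
    · intro j _ hji
      rw [MvPolynomial.coeff_smul, hoff i j (Ne.symm hji), smul_zero]
    · intro hi'; exact absurd hi hi'
  -- transfer into `W`
  have hli' : LinearIndependent ℂ (fun i => (⟨u i, huW i⟩ : W)) :=
    LinearIndependent.of_comp W.subtype (by exact hli)
  have := hli'.fintype_card_le_finrank
  rwa [Fintype.card_fin] at this

/-- **Small stable spaces of affine forms are invariant.**  A finite-dimensional subspace `W` of polynomials of total degree
`≤ 1` on the `n × n` matrix, stable under the diagonal action of every permutation, with `4·dim W + 8 ≤ n`, consists of
invariant polynomials. [folklore] -/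
theorem forall_ren_eq_of_finrank {W : Submodule ℂ (MvPolynomial (Fin n × Fin n) ℂ)} [FiniteDimensional ℂ W]
    (hdeg : ∀ w ∈ W, MvPolynomial.totalDegree w ≤ 1)
    (hstab : ∀ (σ : Perm (Fin n)) (w : MvPolynomial (Fin n × Fin n) ℂ), w ∈ W → ren σ w ∈ W)
    (hdim : 4 * Module.finrank ℂ W + 8 ≤ n) :
    ∀ w ∈ W, ∀ σ : Perm (Fin n), ren σ w = w := by
  have hswap : ∀ w ∈ W, ∀ a b : Fin n, ren (swap a b) w = w := by
    intro w hw a b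
    by_contra hmove
    have := le_finrank_of_swap_moves hdeg hstab hw hmove (m := Module.finrank ℂ W + 1) (by omega)
    omega
  intro w hw σ
  induction σ using Equiv.Perm.swap_induction_on with
  | one => exact ren_one w
  | swap_mul f x y _ ih => rw [ren_mul, ih, hswap w hw x y]

/-- The same for the span of a finite set of affine forms: if the span is stable and `4·|S| + 8 ≤ n`, every form in the
span is invariant (the dimension is at most `|S|`). [folklore] -/
theorem forall_ren_eq_of_span {S : Finset (MvPolynomial (Fin n × Fin n) ℂ)} (hdeg : ∀ w ∈ S, MvPolynomial.totalDegree w ≤ 1)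
    (hstab : ∀ (σ : Perm (Fin n)), ∀ w ∈ S, ren σ w ∈ Submodule.span ℂ (S : Set (MvPolynomial (Fin n × Fin n) ℂ)))
    (hcard : 4 * S.card + 8 ≤ n) :
    ∀ w ∈ Submodule.span ℂ (S : Set (MvPolynomial (Fin n × Fin n) ℂ)), ∀ σ : Perm (Fin n), ren σ w = w := by
  haveI : FiniteDimensional ℂ (Submodule.span ℂ (S : Set (MvPolynomial (Fin n × Fin n) ℂ))) :=
    FiniteDimensional.span_finset ℂ S
  have hdegW : ∀ w ∈ Submodule.span ℂ (S : Set (MvPolynomial (Fin n × Fin n) ℂ)), MvPolynomial.totalDegree w ≤ 1 := by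
    intro w hw
    induction hw using Submodule.span_induction with
    | mem w hw => exact hdeg w hw
    | zero => simp
    | add x y _ _ hx hy => exact (MvPolynomial.totalDegree_add x y).trans (max_le hx hy)
    | smul a x _ hx => exact (MvPolynomial.totalDegree_smul_le a x).trans hx
  have hstabW : ∀ (σ : Perm (Fin n)) (w : MvPolynomial (Fin n × Fin n) ℂ),
      w ∈ Submodule.span ℂ (S : Set (MvPolynomial (Fin n × Fin n) ℂ)) →
        ren σ w ∈ Submodule.span ℂ (S : Set (MvPolynomial (Fin n × Fin n) ℂ)) := by
    intro σ w hw
    induction hw using Submodule.span_induction with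
    | mem w hw => exact hstab σ w hw
    | zero => simp
    | add x y _ _ hx hy => rw [map_add]; exact Submodule.add_mem _ hx hy
    | smul a x _ hx => rw [map_smul]; exact Submodule.smul_mem _ a hx
  have hfin : Module.finrank ℂ (Submodule.span ℂ (S : Set (MvPolynomial (Fin n × Fin n) ℂ))) ≤ S.card :=
    finrank_span_finset_le_card S
  exact forall_ren_eq_of_finrank hdegW hstabW (by omega)

/-! ### Invariant affine forms are combinations of `1`, `Σ_p x_pp`, `Σ_{p≠q} x_pq` -/

/-- Transitivity on positions: two off-diagonal positions are related by a permutation, and so are two diagonal ones.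
[folklore] -/
theorem exists_perm_map_pos {P Q : Fin n × Fin n} (h : (P.1 = P.2) ↔ (Q.1 = Q.2)) :
    ∃ σ : Perm (Fin n), σ • P = Q := by
  let f : Fin n → Fin n := fun x => if x = P.1 then Q.1 else Q.2
  have hf : Set.InjOn f ({P.1, P.2} : Finset (Fin n)) := by
    intro x hx y hy hxy
    simp only [Finset.coe_insert, Finset.coe_singleton, Set.mem_insert_iff, Set.mem_singleton_iff] at hx hy
    by_cases hP : P.1 = P.2
    · rw [hP] at hx hy; rcases hx with rfl | rfl <;> rcases hy with rfl | rfl <;> rfl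
    · have hQ : Q.1 ≠ Q.2 := fun hQ => hP (h.2 hQ)
      rcases hx with rfl | rfl <;> rcases hy with rfl | rfl
      · rfl
      · simp only [f, if_pos rfl, if_neg (Ne.symm hP)] at hxy; exact absurd hxy hQ
      · simp only [f, if_pos rfl, if_neg (Ne.symm hP)] at hxy; exact absurd hxy.symm hQ
      · rfl
  obtain ⟨σ, hσ⟩ := exists_perm_extend hf
  refine ⟨σ, Prod.ext ?_ ?_⟩
  · rw [Prod.smul_fst, Perm.smul_def, hσ _ (by simp)]; simp [f]
  · rw [Prod.smul_snd, Perm.smul_def, hσ _ (by simp)]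
    simp only [f]
    by_cases hP : P.2 = P.1
    · rw [if_pos hP]; exact h.1 hP.symm
    · rw [if_neg hP]

/-- **An invariant polynomial of total degree `≤ 1` is `c₀ + a·Σ_p x_pp + b·Σ_{p≠q} x_pq`.** [folklore] -/
theorem eq_of_invariant_affine {w : MvPolynomial (Fin n × Fin n) ℂ} (hdeg : w.totalDegree ≤ 1)
    (hinv : ∀ σ : Perm (Fin n), ren σ w = w) :
    ∃ c₀ a b : ℂ, w = MvPolynomial.C c₀ +
      MvPolynomial.C a * (∑ P ∈ Finset.univ.filter (fun P : Fin n × Fin n => P.1 = P.2), MvPolynomial.X P) +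
      MvPolynomial.C b * (∑ P ∈ Finset.univ.filter (fun P : Fin n × Fin n => ¬ P.1 = P.2), MvPolynomial.X P) := by
  obtain ⟨c, hc⟩ : ∃ c : Fin n × Fin n → ℂ, ∀ P, c P = MvPolynomial.coeff (Finsupp.single P 1) w :=
    ⟨_, fun _ => rfl⟩
  have hwe : w = MvPolynomial.C (MvPolynomial.coeff 0 w) + ∑ P, MvPolynomial.C (c P) * MvPolynomial.X P := by
    simp only [hc]; exact eqvTerms_affine_eq w hdeg
  -- the coefficient function is invariant
  have hcinv : ∀ (σ : Perm (Fin n)) (P : Fin n × Fin n), c (σ • P) = c P := by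
    intro σ P
    have h' := coeff_single_ren σ w (σ • P)
    rw [hinv, inv_smul_smul] at h'
    rw [hc, hc]; exact h'
  -- hence constant on the diagonal and off the diagonal
  have hconst : ∀ P Q : Fin n × Fin n, ((P.1 = P.2) ↔ (Q.1 = Q.2)) → c P = c Q := by
    intro P Q h
    obtain ⟨σ, hσ⟩ := exists_perm_map_pos h
    rw [← hσ, hcinv]
  obtain ⟨a, ha⟩ : ∃ a : ℂ, ∀ P : Fin n × Fin n, P.1 = P.2 → c P = a := by
    by_cases hex : ∃ P : Fin n × Fin n, P.1 = P.2
    · obtain ⟨P₀, hP₀⟩ := hex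
      exact ⟨c P₀, fun P hP => hconst P P₀ ⟨fun _ => hP₀, fun _ => hP⟩⟩
    · exact ⟨0, fun P hP => absurd ⟨P, hP⟩ hex⟩
  obtain ⟨b, hb⟩ : ∃ b : ℂ, ∀ P : Fin n × Fin n, ¬ P.1 = P.2 → c P = b := by
    by_cases hex : ∃ P : Fin n × Fin n, ¬ P.1 = P.2
    · obtain ⟨P₀, hP₀⟩ := hex
      exact ⟨c P₀, fun P hP => hconst P P₀ ⟨fun h1 => absurd h1 hP, fun h2 => absurd h2 hP₀⟩⟩
    · exact ⟨0, fun P hP => absurd ⟨P, hP⟩ hex⟩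
  have hd : ∑ P ∈ Finset.univ.filter (fun P : Fin n × Fin n => P.1 = P.2), MvPolynomial.C (c P) * MvPolynomial.X P =
      MvPolynomial.C a * ∑ P ∈ Finset.univ.filter (fun P : Fin n × Fin n => P.1 = P.2), MvPolynomial.X P := by
    rw [Finset.mul_sum]
    exact Finset.sum_congr rfl fun P hP => by rw [ha P (Finset.mem_filter.1 hP).2]
  have ho : ∑ P ∈ Finset.univ.filter (fun P : Fin n × Fin n => ¬ P.1 = P.2), MvPolynomial.C (c P) * MvPolynomial.X P =
      MvPolynomial.C b * ∑ P ∈ Finset.univ.filter (fun P : Fin n × Fin n => ¬ P.1 = P.2), MvPolynomial.X P := by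
    rw [Finset.mul_sum]
    exact Finset.sum_congr rfl fun P hP => by rw [hb P (Finset.mem_filter.1 hP).2]
  refine ⟨MvPolynomial.coeff 0 w, a, b, ?_⟩
  rw [← hd, ← ho, add_assoc, Finset.sum_filter_add_sum_filter_not]
  exact hwe

/-- **Small stable spaces of affine forms lie in `span(1, Σ_p x_pp, Σ_{p≠q} x_pq)`** (the form used by the Structure Theorem of
the bounded-fan-in sub-rung: the non-linear part of every cluster sum is a bivariate polynomial in the two invariant forms).
[folklore] -/
theorem exists_eq_of_finrank {W : Submodule ℂ (MvPolynomial (Fin n × Fin n) ℂ)} [FiniteDimensional ℂ W]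
    (hdeg : ∀ w ∈ W, MvPolynomial.totalDegree w ≤ 1)
    (hstab : ∀ (σ : Perm (Fin n)) (w : MvPolynomial (Fin n × Fin n) ℂ), w ∈ W → ren σ w ∈ W)
    (hdim : 4 * Module.finrank ℂ W + 8 ≤ n) :
    ∀ w ∈ W, ∃ c₀ a b : ℂ, w = MvPolynomial.C c₀ +
      MvPolynomial.C a * (∑ P ∈ Finset.univ.filter (fun P : Fin n × Fin n => P.1 = P.2), MvPolynomial.X P) +
      MvPolynomial.C b * (∑ P ∈ Finset.univ.filter (fun P : Fin n × Fin n => ¬ P.1 = P.2), MvPolynomial.X P) :=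
  fun w hw => eq_of_invariant_affine (hdeg w hw) (forall_ren_eq_of_finrank hdeg hstab hdim w hw)

end StableForms

end Summit.ValiantsHypothesis.ValiantsHypothesis.Theorems

end
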